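import Summits.Schanuel.Schanuel.Theorems.RootDecomp1EGenericScale04
import Summits.Schanuel.Schanuel.Theses.RootDecomp1E

/-!
# RootDecomp1EGenericScale — lens 2, generation 38 «GENERIC-SCALE INDUCTION STEP» (kernel: radical descent over an arbitrary type function; cells below the E-R19 floor) — continuation (RootDecomp1EGenericScale05): §5 the class `GenericScale` / `InGenericScaleClass` / `InGenericScaleLineClass` and the cells against the LIVE items (Theses import here FIRST)

(lens-2 g38 `GenericScale.lean` EDITION 2 [HOME/decomp-schanuel-lens-2/g38/GenericScale.lean EDITION 2 sha256 cf4f06e4…1307, 1762 l (ed.1 b58a0d29…; proof-only reshape `type_clash`, NOTE/EDITION2 L1842, writer re-check L1845) + GenericScaleCtrl ed.2 84ae4551… + NODE-g38.md ffd0a60c…; NODE L1822 / REQUEST L1823; critic ACK + OBJECTION L1800, VERDICT L1833]; port by census-1 gen 16 in six parts — see the PORT NOTE of part 01; `--supports stmt-Schanuel-31409`; rung 0.)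
-/

noncomputable section

open Complex

namespace Summit.Schanuel.Schanuel.Theorems.RootDecomp1EGenericScale

open MvPolynomial
open Summit.Schanuel.Schanuel.Theorems.RootDecomp1KHyper (mvlen mvlen_nonneg abs_coeff_le_mvlen one_le_mvlen
  exists_ball_eval_ne_zero)
open Summit.Schanuel.Schanuel.Theorems.RootDecomp1BRadicalDescent

/-! ## §5 The class and the cells -/

section Cells

open Summit.Schanuel.Schanuel.Theses.RootDecomp1E (EStableDefectOne PlainDefectOne DefectOneSchanuel)

/-- **`GenericScale v ρ`** — the scale `ρ` is type-Liouville relative to the relative type function of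
the tuple `v`: it admits rational approximations `|ρ − p/q| < exp(−q³) · relTypeFn v (q²) (2^{q³})` with
`q` arbitrarily large. A dense `G_δ` of reals for EVERY `v` (§6). -/
def GenericScale {N : ℕ} (v : Fin N → ℂ) (ρ : ℝ) : Prop := TypeLiouville (relTypeFn v) ρ

/-- **`InGenericScaleClass z` — THE CELL LINE.** `z` contains an `m`-sub-tuple `w = z ∘ ι` and, outside
it, the coordinate `z j = ρ · w_{i₀}` where `e^{w_{i₀}}` is transcendental and `ρ > 0` is a generic scale
relative to the coordinate tuple `(w, e^w)`; `n ≤ m + 2` (so at most ONE further, ARBITRARY, coordinate). -/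
def InGenericScaleClass {n : ℕ} (z : Fin n → ℂ) : Prop :=
  ∃ (m : ℕ) (ι : Fin m ↪ Fin n) (j : Fin n) (i₀ : Fin m) (ρ : ℝ),
    j ∉ Set.range ι ∧ n ≤ m + 2 ∧ z j = (ρ : ℂ) * z (ι i₀) ∧
      Transcendental ℚ (cexp (z (ι i₀))) ∧ 0 < ρ ∧ GenericScale (coordFamily (z ∘ ι)) ρ

/-- **`InGenericScaleLineClass z`** — the same with `n ≤ m + 1`, i.e. `z = (w, ρ · w_{i₀})` up to order:
on this class the step yields `S` ITSELF from defect `≤ 1` below. -/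
def InGenericScaleLineClass {n : ℕ} (z : Fin n → ℂ) : Prop :=
  ∃ (m : ℕ) (ι : Fin m ↪ Fin n) (j : Fin n) (i₀ : Fin m) (ρ : ℝ),
    j ∉ Set.range ι ∧ n ≤ m + 1 ∧ z j = (ρ : ℂ) * z (ι i₀) ∧
      Transcendental ℚ (cexp (z (ι i₀))) ∧ 0 < ρ ∧ GenericScale (coordFamily (z ∘ ι)) ρ

/-- A generic-scale line is a generic-scale tuple. -/
theorem InGenericScaleLineClass.inGenericScaleClass {n : ℕ} {z : Fin n → ℂ}
    (h : InGenericScaleLineClass z) : InGenericScaleClass z := by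
  obtain ⟨m, ι, j, i₀, ρ, hj, hn, hzj, htr, hρ0, hρ⟩ := h
  exact ⟨m, ι, j, i₀, ρ, hj, by omega, hzj, htr, hρ0, hρ⟩

/-- **CORE CELL (defect ≤ 1 from the first-failure hypothesis).** The first-failure binder of items
31409 / 31410 — defect `≤ 1` on the ℚ-free sub-tuples of the span of strictly smaller length — is
CONSUMED at `(m, z ∘ ι)`. -/
theorem defectOne_of_firstFailure {n : ℕ} {z : Fin n → ℂ} (hz : LinearIndependent ℚ z)
    (hc : InGenericScaleClass z)
    (hIH : ∀ (m : ℕ) (w : Fin m → ℂ), m < n → LinearIndependent ℚ w →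
      (∀ j, w j ∈ Submodule.span ℚ (Set.range z)) →
        (m : Cardinal) ≤ Algebra.trdeg ℚ ↥(IntermediateField.adjoin ℚ
          (Set.range w ∪ Set.range (Complex.exp ∘ w))) + 1) :
    (n : Cardinal) ≤ Algebra.trdeg ℚ ↥(IntermediateField.adjoin ℚ
      (Set.range z ∪ Set.range (Complex.exp ∘ z))) + 1 := by
  obtain ⟨m, ι, j, i₀, ρ, hj, hn, hzj, htr, hρ0, hρ⟩ := hc
  have hmn : m < n := lt_of_notMem_range ι j hj
  have hw : LinearIndependent ℚ (z ∘ ι) := hz.comp ι ι.injective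
  have hspan : ∀ l, (z ∘ ι) l ∈ Submodule.span ℚ (Set.range z) := fun l =>
    Submodule.subset_span ⟨ι l, rfl⟩
  have hstep := defect_step ι j i₀ hzj htr hρ0 hρ (hIH m (z ∘ ι) hmn hw hspan)
  have hnm : n ≤ m + 1 + 1 := by omega
  calc (n : Cardinal) ≤ ((m + 1 + 1 : ℕ) : Cardinal) := by exact_mod_cast hnm
    _ = ((m + 1 : ℕ) : Cardinal) + 1 := Nat.cast_succ (m + 1)
    _ ≤ _ := by gcongr

/-- **CORE CELL, `S` ITSELF on the line class** from defect `≤ 1` below. -/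
theorem schanuel_of_firstFailure_line {n : ℕ} {z : Fin n → ℂ} (hz : LinearIndependent ℚ z)
    (hc : InGenericScaleLineClass z)
    (hIH : ∀ (m : ℕ) (w : Fin m → ℂ), m < n → LinearIndependent ℚ w →
      (∀ j, w j ∈ Submodule.span ℚ (Set.range z)) →
        (m : Cardinal) ≤ Algebra.trdeg ℚ ↥(IntermediateField.adjoin ℚ
          (Set.range w ∪ Set.range (Complex.exp ∘ w))) + 1) :
    (n : Cardinal) ≤ Algebra.trdeg ℚ ↥(IntermediateField.adjoin ℚ
      (Set.range z ∪ Set.range (Complex.exp ∘ z))) := by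
  obtain ⟨m, ι, j, i₀, ρ, hj, hn, hzj, htr, hρ0, hρ⟩ := hc
  have hmn : m < n := lt_of_notMem_range ι j hj
  have hw : LinearIndependent ℚ (z ∘ ι) := hz.comp ι ι.injective
  have hspan : ∀ l, (z ∘ ι) l ∈ Submodule.span ℚ (Set.range z) := fun l =>
    Submodule.subset_span ⟨ι l, rfl⟩
  have hstep := defect_step ι j i₀ hzj htr hρ0 hρ (hIH m (z ∘ ι) hmn hw hspan)
  calc (n : Cardinal) ≤ ((m + 1 : ℕ) : Cardinal) := by exact_mod_cast (by omega : n ≤ m + 1)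
    _ ≤ _ := hstep

/-! ### The LIVE items of route `RootDecomp1E` — texts by `Iff.rfl`, then the cells: the item's binders
VERBATIM with ONE cell line `InGenericScaleClass z` inserted after `LinearIndependent ℚ z`. -/

/-- text of item 31409 `EStableDefectOne` (LIVE, `Iff.rfl`) -/
theorem eStableDefectOne_iff : EStableDefectOne ↔
    ∀ (n : ℕ) (z : Fin n → ℂ), LinearIndependent ℚ z →
      (∃ β : ℂ, IsAlgebraic ℚ β ∧ β ∉ Set.range (algebraMap ℚ ℂ) ∧
        ∀ i, β * z i ∈ Submodule.span ℚ (Set.range z)) →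
      (∀ (m : ℕ) (w : Fin m → ℂ), m < n → LinearIndependent ℚ w →
        (∀ j, w j ∈ Submodule.span ℚ (Set.range z)) →
          (m : Cardinal) ≤ Algebra.trdeg ℚ ↥(IntermediateField.adjoin ℚ
            (Set.range w ∪ Set.range (Complex.exp ∘ w))) + 1) →
      (n : Cardinal) ≤ Algebra.trdeg ℚ ↥(IntermediateField.adjoin ℚ
        (Set.range z ∪ Set.range (Complex.exp ∘ z))) + 1 := Iff.rfl

/-- **CELL of item 31409 `EStableDefectOne` on `InGenericScaleClass`** — binders verbatim, the E-stability
binder CARRIED (unused), the first-failure binder CONSUMED. -/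
theorem eStableDefectOne_genericScaleCell :
    ∀ (n : ℕ) (z : Fin n → ℂ), LinearIndependent ℚ z → InGenericScaleClass z →
      (∃ β : ℂ, IsAlgebraic ℚ β ∧ β ∉ Set.range (algebraMap ℚ ℂ) ∧
        ∀ i, β * z i ∈ Submodule.span ℚ (Set.range z)) →
      (∀ (m : ℕ) (w : Fin m → ℂ), m < n → LinearIndependent ℚ w →
        (∀ j, w j ∈ Submodule.span ℚ (Set.range z)) →
          (m : Cardinal) ≤ Algebra.trdeg ℚ ↥(IntermediateField.adjoin ℚ
            (Set.range w ∪ Set.range (Complex.exp ∘ w))) + 1) →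
      (n : Cardinal) ≤ Algebra.trdeg ℚ ↥(IntermediateField.adjoin ℚ
        (Set.range z ∪ Set.range (Complex.exp ∘ z))) + 1 :=
  fun _ _ hz hc _ hIH => defectOne_of_firstFailure hz hc hIH

/-- item 31409 restricts to the cell's statement (positional link) -/
theorem eStableDefectOne_restrict (h : EStableDefectOne) :
    ∀ (n : ℕ) (z : Fin n → ℂ), LinearIndependent ℚ z → InGenericScaleClass z →
      (∃ β : ℂ, IsAlgebraic ℚ β ∧ β ∉ Set.range (algebraMap ℚ ℂ) ∧
        ∀ i, β * z i ∈ Submodule.span ℚ (Set.range z)) →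
      (∀ (m : ℕ) (w : Fin m → ℂ), m < n → LinearIndependent ℚ w →
        (∀ j, w j ∈ Submodule.span ℚ (Set.range z)) →
          (m : Cardinal) ≤ Algebra.trdeg ℚ ↥(IntermediateField.adjoin ℚ
            (Set.range w ∪ Set.range (Complex.exp ∘ w))) + 1) →
      (n : Cardinal) ≤ Algebra.trdeg ℚ ↥(IntermediateField.adjoin ℚ
        (Set.range z ∪ Set.range (Complex.exp ∘ z))) + 1 :=
  fun n z hz _ hE hIH => h n z hz hE hIH

/-- text of item 31410 `PlainDefectOne` (LIVE, `Iff.rfl`) -/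
theorem plainDefectOne_iff : PlainDefectOne ↔
    ∀ (n : ℕ) (z : Fin n → ℂ), LinearIndependent ℚ z →
      (∀ β : ℂ, IsAlgebraic ℚ β → (∀ i, β * z i ∈ Submodule.span ℚ (Set.range z)) →
        β ∈ Set.range (algebraMap ℚ ℂ)) →
      (∀ (m : ℕ) (w : Fin m → ℂ), m < n → LinearIndependent ℚ w →
        (∀ j, w j ∈ Submodule.span ℚ (Set.range z)) →
          (m : Cardinal) ≤ Algebra.trdeg ℚ ↥(IntermediateField.adjoin ℚ
            (Set.range w ∪ Set.range (Complex.exp ∘ w))) + 1) →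
      (n : Cardinal) ≤ Algebra.trdeg ℚ ↥(IntermediateField.adjoin ℚ
        (Set.range z ∪ Set.range (Complex.exp ∘ z))) + 1 := Iff.rfl

/-- **CELL of item 31410 `PlainDefectOne` on `InGenericScaleClass`** — binders verbatim, the plainness
binder CARRIED (unused), the first-failure binder CONSUMED. -/
theorem plainDefectOne_genericScaleCell :
    ∀ (n : ℕ) (z : Fin n → ℂ), LinearIndependent ℚ z → InGenericScaleClass z →
      (∀ β : ℂ, IsAlgebraic ℚ β → (∀ i, β * z i ∈ Submodule.span ℚ (Set.range z)) →
        β ∈ Set.range (algebraMap ℚ ℂ)) →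
      (∀ (m : ℕ) (w : Fin m → ℂ), m < n → LinearIndependent ℚ w →
        (∀ j, w j ∈ Submodule.span ℚ (Set.range z)) →
          (m : Cardinal) ≤ Algebra.trdeg ℚ ↥(IntermediateField.adjoin ℚ
            (Set.range w ∪ Set.range (Complex.exp ∘ w))) + 1) →
      (n : Cardinal) ≤ Algebra.trdeg ℚ ↥(IntermediateField.adjoin ℚ
        (Set.range z ∪ Set.range (Complex.exp ∘ z))) + 1 :=
  fun _ _ hz hc _ hIH => defectOne_of_firstFailure hz hc hIH

/-- text of item 25020 `DefectOneSchanuel` (LIVE, `Iff.rfl`) -/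
theorem defectOneSchanuel_iff : DefectOneSchanuel ↔
    ∀ (n : ℕ) (z : Fin n → ℂ), LinearIndependent ℚ z →
      (n : Cardinal) ≤ Algebra.trdeg ℚ ↥(IntermediateField.adjoin ℚ
        (Set.range z ∪ Set.range (Complex.exp ∘ z))) + 1 := Iff.rfl

/-- **INDUCTION STEP for item 25020 `DefectOneSchanuel`**: defect `≤ 1` at every length `< n` gives
defect `≤ 1` at length `n` on `InGenericScaleClass`. -/
theorem defectOneSchanuel_genericScaleStep (n : ℕ)
    (hD : ∀ (m : ℕ) (w : Fin m → ℂ), m < n → LinearIndependent ℚ w →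
      (m : Cardinal) ≤ Algebra.trdeg ℚ ↥(IntermediateField.adjoin ℚ
        (Set.range w ∪ Set.range (Complex.exp ∘ w))) + 1) :
    ∀ z : Fin n → ℂ, LinearIndependent ℚ z → InGenericScaleClass z →
      (n : Cardinal) ≤ Algebra.trdeg ℚ ↥(IntermediateField.adjoin ℚ
        (Set.range z ∪ Set.range (Complex.exp ∘ z))) + 1 :=
  fun _ hz hc => defectOne_of_firstFailure hz hc (fun m w hm hw _ => hD m w hm hw)

/-- **`S` ITSELF on the line class from defect `≤ 1` below** (in particular from `DefectOneSchanuel`). -/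
theorem schanuel_genericScaleLineStep (n : ℕ)
    (hD : ∀ (m : ℕ) (w : Fin m → ℂ), m < n → LinearIndependent ℚ w →
      (m : Cardinal) ≤ Algebra.trdeg ℚ ↥(IntermediateField.adjoin ℚ
        (Set.range w ∪ Set.range (Complex.exp ∘ w))) + 1) :
    ∀ z : Fin n → ℂ, LinearIndependent ℚ z → InGenericScaleLineClass z →
      (n : Cardinal) ≤ Algebra.trdeg ℚ ↥(IntermediateField.adjoin ℚ
        (Set.range z ∪ Set.range (Complex.exp ∘ z))) :=
  fun _ hz hc => schanuel_of_firstFailure_line hz hc (fun m w hm hw _ => hD m w hm hw)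

/-- `DefectOneSchanuel` ⟹ `S` on the line class at every length. -/
theorem schanuel_genericScaleLine_of_defectOne (hD : DefectOneSchanuel) (n : ℕ) (z : Fin n → ℂ)
    (hz : LinearIndependent ℚ z) (hc : InGenericScaleLineClass z) :
    (n : Cardinal) ≤ Algebra.trdeg ℚ ↥(IntermediateField.adjoin ℚ
      (Set.range z ∪ Set.range (Complex.exp ∘ z))) :=
  schanuel_genericScaleLineStep n (fun m w _ hw => hD m w hw) z hz hc

end Cells

end Summit.Schanuel.Schanuel.Theorems.RootDecomp1EGenericScale

end
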